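import Summits.AtomisticToContinuum.HydrodynamicLimit.Theorems.OneFlightGossipEngineClampedCurrentsDockWindowBalance
import Summits.AtomisticToContinuum.HydrodynamicLimit.Theorems.LambertianContactSwapLambertianEulerJointMeasurable
import Summits.AtomisticToContinuum.HydrodynamicLimit.Theorems.TwoClocksClampedEntropyClockKlDivLawAtLocalGibbsNeTop
import Literature.MathematicalPhysics.KineticTheory.LambertianRedrawNondegenerate
import HarnessLib

/-!
# Tools for the production split of the Lambertian gas (crux `LambertianEuler`, stmt-AtomisticToContinuum-11854,
# line `Sketch`; helpers of the stub B2 `stub_productionSplitLambda`)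

Helper file (`--supports`) of the crux
`Summit.AtomisticToContinuum.HydrodynamicLimit.Theses.LambertianContactSwap.LambertianEuler`, line `Sketch`:
* `integrable_window_functional` — under local Gibbs data ⊗ Lambertian noise, for a jointly measurable one-body
  observable `G(r, x, v)` of cubic growth in `v` uniformly on a window `[s, s′]`, `((z, ξs), r) ↦ Σ_i G(r, (Λ_r)_i)` is
  integrable on `λ ⊗ dr|_{(s, s′]}` (joint measurability of `Λ`, `E(Λ_r) ≤ E(z)`, second and fourth Gaussian velocity
  moments), hence the window functional `p ↦ ∫_s^{s′} Σ_i G(r, (Λ_r p)_i) dr` is `λ`-integrable;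
* continuity and cubic-growth templates for the fast kinetic current `Y⊥` and the collisional counter-terms `X` of
  the Euler cancellation (`ClampedCurrentsDockCancellation.EulerCancellation`: `Dg + X = Y⊥`) over abstract continuous
  coefficient fields on `ℝ × 𝕋³` (`continuous_Y_aux`, `continuous_X_aux`, `exists_abs_Y_le`, `exists_abs_X_le`), to be
  instantiated with the profiles and their derivatives clamped in time to the window (`continuous_clamp`).
References: H.-T. Yau, Lett. Math. Phys. 22 (1991) §2; measure theory otherwise. All `[folklore]`.
-/


noncomputable section

namespace Summit.AtomisticToContinuum.HydrodynamicLimit.Theorems.LambertianContactSwapLambertianEulerProductionSplitTools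

open scoped BigOperators Topology ENNReal InnerProductSpace
open MeasureTheory ProbabilityTheory Filter Set InformationTheory
open Literature.MathematicalPhysics.KineticTheory
open Literature.Analysis.FluidPDE Literature.Analysis.FluidPDE.Alexander
open Literature.Analysis.FunctionSpaces

/-! ## §1 Window functionals of one-body observables of cubic growth along the Lambertian flow -/

section Window

/-- Summing a cubic one-body bound over the particles: `|Σ_i G(w_i)| ≤ (N+1) C (3 + 5E + E²)`,
`E = Σ_i |v_i|²` (`|v_i| ≤ √E`, `(1 + √E)³ ≤ 3 + 5E + E²`). [folklore] -/
theorem abs_sum_le_of_cubic {N : ℕ} {G : T3 × V3 → ℝ} {C : ℝ} (hC0 : 0 ≤ C)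
    (hC : ∀ y : T3 × V3, |G y| ≤ C * (1 + ‖y.2‖) ^ 3) (w : Config (N + 1) (Fin 3) T3) :
    |∑ i, G (w i)| ≤ ((N : ℝ) + 1) * C * (3 + 5 * ∑ i, ‖(w i).2‖ ^ 2 + (∑ i, ‖(w i).2‖ ^ 2) ^ 2) := by
  -- adapted from `ClampedCurrentsDockWindowBalance.abs_DgSum_le`
  set E := ∑ i, ‖(w i).2‖ ^ 2 with hE_def
  have hE : 0 ≤ E := Finset.sum_nonneg fun i _ => by positivity
  have hi : ∀ i, ‖(w i).2‖ ≤ Real.sqrt E := fun i => by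
    rw [← Real.sqrt_sq (norm_nonneg (w i).2)]
    exact Real.sqrt_le_sqrt (Finset.single_le_sum (f := fun j => ‖(w j).2‖ ^ 2)
      (fun j _ => by positivity) (Finset.mem_univ i))
  have hpoly : (1 + Real.sqrt E) ^ 3 ≤ 3 + 5 * E + E ^ 2 := by
    have hs : Real.sqrt E ^ 2 = E := Real.sq_sqrt hE
    nlinarith [mul_nonneg (sq_nonneg (Real.sqrt E - 1)) (add_nonneg (sq_nonneg (Real.sqrt E)) zero_le_three),
      Real.sqrt_nonneg E, sq_nonneg E]
  calc |∑ i, G (w i)| ≤ ∑ i, |G (w i)| := Finset.abs_sum_le_sum_abs _ _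
    _ ≤ ∑ _i : Fin (N + 1), C * (1 + Real.sqrt E) ^ 3 := Finset.sum_le_sum fun i _ =>
        (hC (w i)).trans (by gcongr; exact hi i)
    _ = ((N : ℝ) + 1) * C * (1 + Real.sqrt E) ^ 3 := by
        simp only [Finset.sum_const, Finset.card_univ, Fintype.card_fin, nsmul_eq_mul, Nat.cast_add, Nat.cast_one]
        ring
    _ ≤ ((N : ℝ) + 1) * C * (3 + 5 * E + E ^ 2) := by gcongr

/-- **Window functionals of jointly measurable one-body observables of cubic growth are integrable along `Λ`**
(local Gibbs data ⊗ Lambertian noise, `0 < σ < 1/2`; `G` measurable with `|G(r, x, v)| ≤ C (1 + |v|)³` on `[s, s′]`):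
`((z, ξs), r) ↦ Σ_i G(r, (Λ_r)_i)` is integrable on `λ ⊗ dr|_{(s, s′]}` (joint measurability of `Λ`, `E(Λ_r) ≤ E(z)`,
Cauchy–Schwarz, Gaussian moments), hence `p ↦ ∫_s^{s′} Σ_i G dr` is `λ`-integrable and a.e. section is. [folklore] -/
theorem integrable_window_functional :
    ∀ {σ : ℝ} {a₀ θ₀ : T3 → ℝ} {u₀ : T3 → V3} {N : ℕ}, 0 < σ → σ < 2⁻¹ →
    Continuous a₀ → Continuous θ₀ → Continuous u₀ → (∀ x, 0 < a₀ x) → (∀ x, 0 < θ₀ x) →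
    ∀ (Φ : HardSphereFlow (Torus.geometry (Fin 3)) (hsDiameter σ N) (N + 1)) {G : ℝ × (T3 × V3) → ℝ},
    Measurable G → ∀ {s s' C : ℝ}, s ≤ s' → 0 ≤ C →
    (∀ r ∈ Set.Icc s s', ∀ y : T3 × V3, |G (r, y)| ≤ C * (1 + ‖y.2‖) ^ 3) →
    Integrable (fun q : (Config (N + 1) (Fin 3) T3 × (ℕ → V3)) × ℝ =>
        ∑ i, G (q.2, lambertFlow (Torus.geometry (Fin 3)) (hsDiameter σ N) q.1.2 q.1.1 q.2 i))
      (((localGibbsLaw σ a₀ u₀ θ₀ N Φ).prod (lambertNoise (Fin 3))).prod (volume.restrict (Set.Ioc s s'))) ∧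
    Integrable (fun p : Config (N + 1) (Fin 3) T3 × (ℕ → V3) =>
        ∫ r in s..s', ∑ i, G (r, lambertFlow (Torus.geometry (Fin 3)) (hsDiameter σ N) p.2 p.1 r i))
      ((localGibbsLaw σ a₀ u₀ θ₀ N Φ).prod (lambertNoise (Fin 3))) ∧
    ∀ᵐ p ∂((localGibbsLaw σ a₀ u₀ θ₀ N Φ).prod (lambertNoise (Fin 3))),
      IntegrableOn (fun r => ∑ i, G (r, lambertFlow (Torus.geometry (Fin 3)) (hsDiameter σ N) p.2 p.1 r i))
        (Set.Ioc s s') := by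
  intro σ a₀ θ₀ u₀ N hσ hσ' ha₀ hθ₀ hu₀ ha₀0 hθ₀0 Φ G hGm s s' C hss' hC0 hC
  -- adapted from `LambertianContactSwapLambertianEulerStreamingFubini.integral_window_streaming_swap`
  have hσ2 : σ ≤ 1 / 2 := by rw [one_div]; exact hσ'.le
  haveI : IsProbabilityMeasure (localGibbsLaw σ a₀ u₀ θ₀ N Φ) :=
    isProbabilityMeasure_localGibbsLaw ha₀ hθ₀ hu₀ ha₀0 hθ₀0 hσ2 N Φ
  set P := (localGibbsLaw σ a₀ u₀ θ₀ N Φ).prod (lambertNoise (Fin 3)) with hP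
  set ν : Measure ℝ := volume.restrict (Ioc s s') with hν
  have hΛ := LambertianContactSwapLambertianEulerJointMeasurable.measurable_lambertFlow_uncurry_torus hσ.le hσ' N
  have hFm : Measurable fun q : (Config (N + 1) (Fin 3) T3 × (ℕ → V3)) × ℝ =>
      ∑ i, G (q.2, lambertFlow (Torus.geometry (Fin 3)) (hsDiameter σ N) q.1.2 q.1.1 q.2 i) :=
    Finset.measurable_sum _ fun i _ => hGm.comp (measurable_snd.prodMk ((measurable_pi_apply i).comp hΛ))
  have hae : ∀ᵐ q ∂(P.prod ν), q.2 ∈ Ioc s s' :=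
    (Measure.quasiMeasurePreserving_snd (μ := P) (ν := ν)).ae (ae_restrict_mem measurableSet_Ioc)
  -- domination: second and fourth Gaussian moments, energy monotonicity
  have hE1 : Integrable (fun p : Config (N + 1) (Fin 3) T3 × (ℕ → V3) => ∑ i, ‖(p.1 i).2‖ ^ 2) P :=
    (QuenchedCellClock.integrable_sum_norm_sq_localGibbsLaw ha₀ hθ₀ hu₀ (fun x => (ha₀0 x).le) hθ₀0 N Φ).comp_fst _
  have hE4 : Integrable (fun p : Config (N + 1) (Fin 3) T3 × (ℕ → V3) => ∑ i, ‖(p.1 i).2‖ ^ 4) P :=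
    (ClampedCurrentsDockWindowBalance.integrable_sum_norm_pow_four_localGibbsLaw ha₀ hθ₀ hu₀ (fun x => (ha₀0 x).le)
      hθ₀0 σ N Φ).comp_fst _
  have hBP : Integrable (fun p : Config (N + 1) (Fin 3) T3 × (ℕ → V3) => ((N : ℝ) + 1) * C *
      (3 + 5 * ∑ i, ‖(p.1 i).2‖ ^ 2 + ((N : ℝ) + 1) * ∑ i, ‖(p.1 i).2‖ ^ 4)) P :=
    Integrable.const_mul (((integrable_const _).add (hE1.const_mul _)).add (hE4.const_mul _)) _
  haveI : IsFiniteMeasure ν := by rw [hν]; infer_instance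
  have hB : Integrable (fun q : (Config (N + 1) (Fin 3) T3 × (ℕ → V3)) × ℝ => ((N : ℝ) + 1) * C *
      (3 + 5 * ∑ i, ‖(q.1.1 i).2‖ ^ 2 + ((N : ℝ) + 1) * ∑ i, ‖(q.1.1 i).2‖ ^ 4)) (P.prod ν) := hBP.comp_fst _
  have hInt : Integrable (fun q : (Config (N + 1) (Fin 3) T3 × (ℕ → V3)) × ℝ =>
      ∑ i, G (q.2, lambertFlow (Torus.geometry (Fin 3)) (hsDiameter σ N) q.1.2 q.1.1 q.2 i)) (P.prod ν) := by
    refine hB.mono' hFm.aestronglyMeasurable ?_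
    filter_upwards [hae] with q hq
    have hS0 : 0 ≤ ∑ i, ‖(q.1.1 i).2‖ ^ 2 := Finset.sum_nonneg fun i _ => by positivity
    have hm : ∑ i, ‖(lambertFlow (Torus.geometry (Fin 3)) (hsDiameter σ N) q.1.2 q.1.1 q.2 i).2‖ ^ 2 ≤
        ∑ i, ‖(q.1.1 i).2‖ ^ 2 := by
      have h := configEnergy_lambertFlow_le (G := Torus.geometry (Fin 3)) (ε := hsDiameter σ N) q.1.2 q.1.1 q.2
      simp only [configEnergy] at h
      linarith
    have hL0 : 0 ≤ ∑ i, ‖(lambertFlow (Torus.geometry (Fin 3)) (hsDiameter σ N) q.1.2 q.1.1 q.2 i).2‖ ^ 2 :=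
      Finset.sum_nonneg fun i _ => by positivity
    have hCS : (∑ i, ‖(q.1.1 i).2‖ ^ 2) ^ 2 ≤ ((N : ℝ) + 1) * ∑ i, ‖(q.1.1 i).2‖ ^ 4 := by
      have hcs := sq_sum_le_card_mul_sum_sq (s := Finset.univ) (f := fun i : Fin (N + 1) => ‖(q.1.1 i).2‖ ^ 2)
      simpa only [Finset.card_univ, Fintype.card_fin, Nat.cast_add, Nat.cast_one, ← pow_mul] using hcs
    rw [Real.norm_eq_abs]
    refine (abs_sum_le_of_cubic hC0 (hC q.2 (Ioc_subset_Icc_self hq)) _).trans ?_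
    have hN0 : (0 : ℝ) ≤ ((N : ℝ) + 1) * C := by positivity
    refine mul_le_mul_of_nonneg_left ?_ hN0
    nlinarith [mul_le_mul hm hm hL0 hS0]
  refine ⟨hInt, ?_, hInt.prod_right_ae⟩
  simp only [intervalIntegral.integral_of_le hss']
  exact hInt.integral_prod_left

end Window

/-! ## §2 The fast kinetic current and the collisional counter-terms: continuity and growth templates -/

section Currents

/-- A field with space–time lift continuous on `[0, T) × ℝ³`, clamped in time to a window `[s, s′] ⊆ [0, T)`,
is continuous on `ℝ × 𝕋³` (`id × proj` is an open quotient map). [folklore] -/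
theorem continuous_clamp {F : Type*} [NormedAddCommGroup F] [NormedSpace ℝ F] {ψ : ℝ → T3 → F} {T s s' : ℝ}
    (hψ : ContinuousOn (Torus.stLift ψ) (Ico 0 T ×ˢ univ)) (hs : 0 ≤ s) (hss' : s ≤ s') (hs'T : s' < T) :
    Continuous fun p : ℝ × T3 => ψ (max s (min p.1 s')) p.2 := by
  -- adapted from `LambertianContactSwapLambertianEulerExpectedWindowProductionTools.continuous_gSum_clamp`
  have hcm : ∀ t, max s (min t s') ∈ Ico 0 T := fun t =>
    ⟨hs.trans (le_max_left _ _), (max_le hss' (min_le_right _ _)).trans_lt hs'T⟩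
  have hq : IsOpenQuotientMap (Prod.map id Torus.proj : ℝ × V3 → ℝ × T3) :=
    IsOpenQuotientMap.id.prodMap Torus.isOpenQuotientMap_proj
  have hlift : Continuous fun p : ℝ × V3 => (max s (min p.1 s'), p.2) := by fun_prop
  exact hq.continuous_comp_iff.1 (hψ.comp_continuous hlift fun p => mk_mem_prod (hcm p.1) (mem_univ _))

/-- A continuous function on `ℝ × 𝕋³` is bounded on `[s, s′] × 𝕋³` (compactness). [folklore] -/
theorem exists_forall_norm_le_window {F : Type*} [SeminormedAddCommGroup F] {f : ℝ × T3 → F}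
    (hf : Continuous f) (s s' : ℝ) : ∃ C : ℝ, 0 ≤ C ∧ ∀ t ∈ Icc s s', ∀ x : T3, ‖f (t, x)‖ ≤ C := by
  obtain ⟨C, hC⟩ := (isCompact_Icc.prod isCompact_univ).exists_bound_of_continuousOn
    (s := Icc s s' ×ˢ (univ : Set T3)) hf.continuousOn
  exact ⟨max C 0, le_max_right _ _, fun t ht x =>
    (hC (t, x) (mk_mem_prod ht (mem_univ x))).trans (le_max_left _ _)⟩

/-- A finite family of continuous real functions on `ℝ × 𝕋³` is uniformly bounded on `[s, s′] × 𝕋³`. [folklore] -/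
theorem exists_forall_abs_le_window {ι : Type*} [Fintype ι] {f : ι → ℝ × T3 → ℝ} (hf : ∀ i, Continuous (f i))
    (s s' : ℝ) : ∃ D : ℝ, 0 ≤ D ∧ ∀ t ∈ Icc s s', ∀ (x : T3) (i : ι), |f i (t, x)| ≤ D := by
  obtain ⟨D, hD0, hD⟩ := exists_forall_norm_le_window
    (show Continuous fun p : ℝ × T3 => ∑ i, |f i p| by fun_prop) s s'
  refine ⟨D, hD0, fun t ht x i => ?_⟩
  have h := hD t ht x
  rw [Real.norm_eq_abs, abs_of_nonneg (Finset.sum_nonneg fun _ _ => abs_nonneg _)] at h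
  exact (Finset.single_le_sum (f := fun i' => |f i' (t, x)|) (fun _ _ => abs_nonneg _) (Finset.mem_univ i)).trans h

/-- Continuity template for the clamped fast kinetic current with abstract continuous coefficient fields. [folklore] -/
theorem continuous_Y_aux {Θc : ℝ × T3 → ℝ} {Uc : ℝ × T3 → V3} {dΘ : Fin 3 → ℝ × T3 → ℝ}
    {dU : Fin 3 → Fin 3 → ℝ × T3 → ℝ} (hΘ : Continuous Θc) (hU : Continuous Uc)
    (hdΘ : ∀ k, Continuous (dΘ k)) (hdU : ∀ k j, Continuous (dU k j)) (hΘ0 : ∀ p, Θc p ≠ 0) :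
    Continuous fun q : ℝ × (T3 × V3) =>
      (Θc (q.1, q.2.1))⁻¹ * ∑ j : Fin 3, ∑ k : Fin 3, ((q.2.2 - Uc (q.1, q.2.1)) j * (q.2.2 - Uc (q.1, q.2.1)) k -
          (if j = k then ‖q.2.2 - Uc (q.1, q.2.1)‖ ^ 2 / 3 else 0)) * dU k j (q.1, q.2.1) +
        (‖q.2.2 - Uc (q.1, q.2.1)‖ ^ 2 - 5 * Θc (q.1, q.2.1)) *
          (∑ k : Fin 3, (q.2.2 - Uc (q.1, q.2.1)) k * dΘ k (q.1, q.2.1)) / (2 * Θc (q.1, q.2.1) ^ 2) := by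
  have h1 : ∀ q : ℝ × (T3 × V3), Θc (q.1, q.2.1) ≠ 0 := fun q => hΘ0 _
  have h2 : ∀ q : ℝ × (T3 × V3), 2 * Θc (q.1, q.2.1) ^ 2 ≠ 0 := fun q =>
    mul_ne_zero two_ne_zero (pow_ne_zero 2 (h1 q))
  have hΘ' : Continuous fun q : ℝ × (T3 × V3) => Θc (q.1, q.2.1) := by fun_prop
  have hw : Continuous fun q : ℝ × (T3 × V3) => q.2.2 - Uc (q.1, q.2.1) := by fun_prop
  have hwj : ∀ j, Continuous fun q : ℝ × (T3 × V3) => (q.2.2 - Uc (q.1, q.2.1)) j := fun j => by fun_prop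
  refine Continuous.add ((hΘ'.inv₀ h1).mul (continuous_finsetSum _ fun j _ =>
    continuous_finsetSum _ fun k _ => ?_)) ?_
  · refine (((hwj j).mul (hwj k)).sub ?_).mul (by fun_prop)
    exact Continuous.if_const _ (by fun_prop) continuous_const
  · fun_prop (disch := assumption)

/-- Continuity template for the clamped collisional counter-terms (abstract continuous coefficients). [folklore] -/
theorem continuous_X_aux {σ : ℝ} {Θc Pc Zc Z'c : ℝ × T3 → ℝ} {Uc : ℝ × T3 → V3} {dΘ dQ : Fin 3 → ℝ × T3 → ℝ}
    (hΘ : Continuous Θc) (hP : Continuous Pc) (hZ : Continuous Zc) (hZ' : Continuous Z'c) (hU : Continuous Uc)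
    (hdΘ : ∀ k, Continuous (dΘ k)) (hdQ : ∀ k, Continuous (dQ k)) (hΘ0 : ∀ p, Θc p ≠ 0) :
    Continuous fun q : ℝ × (T3 × V3) =>
      (∑ k : Fin 3, dQ k (q.1, q.2.1)) *
          (Θc (q.1, q.2.1) * (Pc (q.1, q.2.1) * σ ^ 3) * Z'c (q.1, q.2.1) +
            (1 / 3) * (Zc (q.1, q.2.1) - 1) * ‖q.2.2 - Uc (q.1, q.2.1)‖ ^ 2) +
        ((∑ k : Fin 3, Uc (q.1, q.2.1) k * dΘ k (q.1, q.2.1)) / (Θc (q.1, q.2.1)) ^ 2) *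
          (Θc (q.1, q.2.1) * (Pc (q.1, q.2.1) * σ ^ 3) * Z'c (q.1, q.2.1) +
            (1 / 3) * (Zc (q.1, q.2.1) - 1) * ‖q.2.2 - Uc (q.1, q.2.1)‖ ^ 2) +
        (Zc (q.1, q.2.1) - 1) * (∑ k : Fin 3, (q.2.2 - Uc (q.1, q.2.1)) k * dΘ k (q.1, q.2.1)) / Θc (q.1, q.2.1) := by
  have h1 : ∀ q : ℝ × (T3 × V3), Θc (q.1, q.2.1) ≠ 0 := fun q => hΘ0 _
  have h2 : ∀ q : ℝ × (T3 × V3), (Θc (q.1, q.2.1)) ^ 2 ≠ 0 := fun q => pow_ne_zero 2 (h1 q)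
  fun_prop (disch := assumption)

/-- Monomial bookkeeping: for `0 ≤ m ≤ n + W` (`n, W ≥ 0`), `m^k ≤ (1+W)^k (1+n)³`, `k = 1, 2, 3`. [folklore] -/
theorem monomial_le {m n W : ℝ} (hm0 : 0 ≤ m) (hn : 0 ≤ n) (hW : 0 ≤ W) (hm : m ≤ n + W) :
    m ≤ (1 + W) * (1 + n) ^ 3 ∧ m ^ 2 ≤ (1 + W) ^ 2 * (1 + n) ^ 3 ∧ m ^ 3 ≤ (1 + W) ^ 3 * (1 + n) ^ 3 := by
  have h1 : m ≤ (1 + W) * (1 + n) := by nlinarith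
  have hn1 : (1 : ℝ) ≤ 1 + n := by linarith
  have hp : ∀ k ≤ 3, (1 + n) ^ k ≤ (1 + n) ^ 3 := fun k hk => pow_le_pow_right₀ hn1 hk
  refine ⟨(mul_le_mul_of_nonneg_left (hp 1 (by norm_num)) (by positivity)).trans' (by rwa [pow_one]), ?_,
    (pow_le_pow_left₀ hm0 h1 3).trans_eq (by ring)⟩
  exact ((pow_le_pow_left₀ hm0 h1 2).trans_eq (by ring)).trans
    (mul_le_mul_of_nonneg_left (hp 2 (by norm_num)) (by positivity))

/-- `|Σ_k w_k d_k| ≤ 3 |w| D` when `|d_k| ≤ D`. [folklore] -/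
theorem abs_sum_mul_le {w : V3} {d : Fin 3 → ℝ} {D : ℝ} (hd : ∀ k, |d k| ≤ D) :
    |∑ k : Fin 3, w k * d k| ≤ 3 * (‖w‖ * D) := by
  calc |∑ k : Fin 3, w k * d k| ≤ ∑ k : Fin 3, |w k * d k| := Finset.abs_sum_le_sum_abs _ _
    _ ≤ ∑ _k : Fin 3, ‖w‖ * D := Finset.sum_le_sum fun k _ => by
        rw [abs_mul]
        exact mul_le_mul (by simpa only [Real.norm_eq_abs] using PiLp.norm_apply_le w k) (hd k) (abs_nonneg _)
          (norm_nonneg _)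
    _ = 3 * (‖w‖ * D) := by
        simp only [Finset.sum_const, Finset.card_univ, Fintype.card_fin, nsmul_eq_mul, Nat.cast_ofNat]

/-- **The clamped fast kinetic current grows at most cubically in the velocity, uniformly on the window** (template,
abstract continuous coefficients, `Θc ≠ 0`: bounded on the compact `[s, s′] × 𝕋³`; `|w| ≤ |v| + sup |Uc|`). [folklore] -/
theorem exists_abs_Y_le {Θc : ℝ × T3 → ℝ} {Uc : ℝ × T3 → V3} {dΘ : Fin 3 → ℝ × T3 → ℝ}
    {dU : Fin 3 → Fin 3 → ℝ × T3 → ℝ} (hΘ : Continuous Θc) (hU : Continuous Uc)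
    (hdΘ : ∀ k, Continuous (dΘ k)) (hdU : ∀ k j, Continuous (dU k j)) (hΘ0 : ∀ p, Θc p ≠ 0) (s s' : ℝ) :
    ∃ C : ℝ, 0 ≤ C ∧ ∀ t ∈ Icc s s', ∀ (x : T3) (v : V3),
      |(Θc (t, x))⁻¹ * ∑ j : Fin 3, ∑ k : Fin 3, ((v - Uc (t, x)) j * (v - Uc (t, x)) k -
            (if j = k then ‖v - Uc (t, x)‖ ^ 2 / 3 else 0)) * dU k j (t, x) +
          (‖v - Uc (t, x)‖ ^ 2 - 5 * Θc (t, x)) *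
            (∑ k : Fin 3, (v - Uc (t, x)) k * dΘ k (t, x)) / (2 * Θc (t, x) ^ 2)| ≤ C * (1 + ‖v‖) ^ 3 := by
  have h2 : ∀ p : ℝ × T3, 2 * Θc p ^ 2 ≠ 0 := fun p => mul_ne_zero two_ne_zero (pow_ne_zero 2 (hΘ0 p))
  obtain ⟨B, hB0, hB⟩ := exists_forall_norm_le_window
    (show Continuous fun p : ℝ × T3 => (Θc p)⁻¹ from hΘ.inv₀ hΘ0) s s'
  obtain ⟨K, hK0, hK⟩ := exists_forall_norm_le_window
    (show Continuous fun p : ℝ × T3 => (2 * Θc p ^ 2)⁻¹ from (continuous_const.mul (hΘ.pow 2)).inv₀ h2) s s'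
  obtain ⟨Θ, hΘb0, hΘb⟩ := exists_forall_norm_le_window hΘ s s'
  obtain ⟨W, hW0, hW⟩ := exists_forall_norm_le_window hU s s'
  obtain ⟨D, hD0, hDkj⟩ := exists_forall_abs_le_window (f := fun kj : Fin 3 × Fin 3 => dU kj.1 kj.2)
    (fun kj => hdU kj.1 kj.2) s s'
  obtain ⟨D', hD'0, hDk⟩ := exists_forall_abs_le_window hdΘ s s'
  refine ⟨12 * B * D * (1 + W) ^ 2 + 3 * K * D' * ((1 + W) ^ 3 + 5 * Θ * (1 + W)), by positivity,
    fun t ht x v => ?_⟩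
  set w : V3 := v - Uc (t, x) with hw_def
  have hBt : |(Θc (t, x))⁻¹| ≤ B := by simpa only [Real.norm_eq_abs] using hB t ht x
  have hKt : |(2 * Θc (t, x) ^ 2)⁻¹| ≤ K := by simpa only [Real.norm_eq_abs] using hK t ht x
  have hΘt : |Θc (t, x)| ≤ Θ := by simpa only [Real.norm_eq_abs] using hΘb t ht x
  have hwn : ‖w‖ ≤ ‖v‖ + W := (norm_sub_le _ _).trans (add_le_add le_rfl (hW t ht x))
  -- the traceless stress term
  have hS1 : |∑ j : Fin 3, ∑ k : Fin 3, (w j * w k - (if j = k then ‖w‖ ^ 2 / 3 else 0)) * dU k j (t, x)| ≤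
      12 * D * ‖w‖ ^ 2 := by
    calc _ ≤ ∑ j : Fin 3, |∑ k : Fin 3, (w j * w k - (if j = k then ‖w‖ ^ 2 / 3 else 0)) * dU k j (t, x)| :=
          Finset.abs_sum_le_sum_abs _ _
      _ ≤ ∑ j : Fin 3, ∑ k : Fin 3, |(w j * w k - (if j = k then ‖w‖ ^ 2 / 3 else 0)) * dU k j (t, x)| :=
          Finset.sum_le_sum fun j _ => Finset.abs_sum_le_sum_abs _ _
      _ ≤ ∑ _j : Fin 3, ∑ _k : Fin 3, (4 / 3 * ‖w‖ ^ 2) * D := by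
          refine Finset.sum_le_sum fun j _ => Finset.sum_le_sum fun k _ => ?_
          rw [abs_mul]
          refine mul_le_mul ?_ (hDkj t ht x (k, j)) (abs_nonneg _) (by positivity)
          have h1 : |w j * w k| ≤ ‖w‖ ^ 2 := by
            rw [abs_mul, sq]
            exact mul_le_mul (by simpa only [Real.norm_eq_abs] using PiLp.norm_apply_le w j)
              (by simpa only [Real.norm_eq_abs] using PiLp.norm_apply_le w k) (abs_nonneg _) (norm_nonneg _)
          have h2 : |(if j = k then ‖w‖ ^ 2 / 3 else 0)| ≤ ‖w‖ ^ 2 / 3 := by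
            split_ifs
            · rw [abs_of_nonneg (by positivity)]
            · rw [abs_zero]; positivity
          calc _ ≤ |w j * w k| + |(if j = k then ‖w‖ ^ 2 / 3 else 0)| := abs_sub _ _
            _ ≤ ‖w‖ ^ 2 + ‖w‖ ^ 2 / 3 := add_le_add h1 h2
            _ = 4 / 3 * ‖w‖ ^ 2 := by ring
      _ = 12 * D * ‖w‖ ^ 2 := by
          simp only [Finset.sum_const, Finset.card_univ, Fintype.card_fin, nsmul_eq_mul, Nat.cast_ofNat]
          ring
  have hT1 : |(Θc (t, x))⁻¹ * ∑ j : Fin 3, ∑ k : Fin 3, (w j * w k - (if j = k then ‖w‖ ^ 2 / 3 else 0)) *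
      dU k j (t, x)| ≤ B * (12 * D * ‖w‖ ^ 2) := by
    rw [abs_mul]
    exact mul_le_mul hBt hS1 (abs_nonneg _) hB0
  -- the heat-current term
  have hT2 : |(‖w‖ ^ 2 - 5 * Θc (t, x)) * (∑ k : Fin 3, w k * dΘ k (t, x)) / (2 * Θc (t, x) ^ 2)| ≤
      (‖w‖ ^ 2 + 5 * Θ) * (3 * (‖w‖ * D')) * K := by
    rw [div_eq_mul_inv, abs_mul, abs_mul]
    have h5 : |‖w‖ ^ 2 - 5 * Θc (t, x)| ≤ ‖w‖ ^ 2 + 5 * Θ :=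
      calc |‖w‖ ^ 2 - 5 * Θc (t, x)| ≤ |‖w‖ ^ 2| + |5 * Θc (t, x)| := abs_sub _ _
        _ ≤ ‖w‖ ^ 2 + 5 * Θ := by
            rw [abs_of_nonneg (sq_nonneg ‖w‖), abs_mul, abs_of_pos (by norm_num : (0 : ℝ) < 5)]
            exact add_le_add le_rfl (mul_le_mul_of_nonneg_left hΘt (by norm_num))
    exact mul_le_mul (mul_le_mul h5 (abs_sum_mul_le (hDk t ht x)) (abs_nonneg _) (by positivity)) hKt
      (abs_nonneg _) (by positivity)
  -- bookkeeping
  obtain ⟨hm1, hm2, hm3⟩ := monomial_le (norm_nonneg w) (norm_nonneg v) hW0 hwn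
  calc _ ≤ |(Θc (t, x))⁻¹ * ∑ j : Fin 3, ∑ k : Fin 3, (w j * w k - (if j = k then ‖w‖ ^ 2 / 3 else 0)) *
          dU k j (t, x)| + |(‖w‖ ^ 2 - 5 * Θc (t, x)) * (∑ k : Fin 3, w k * dΘ k (t, x)) / (2 * Θc (t, x) ^ 2)| :=
        abs_add_le _ _
    _ ≤ B * (12 * D * ‖w‖ ^ 2) + (‖w‖ ^ 2 + 5 * Θ) * (3 * (‖w‖ * D')) * K := add_le_add hT1 hT2
    _ ≤ (12 * B * D * (1 + W) ^ 2 + 3 * K * D' * ((1 + W) ^ 3 + 5 * Θ * (1 + W))) * (1 + ‖v‖) ^ 3 := by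
        nlinarith [mul_le_mul_of_nonneg_left hm2 (by positivity : (0 : ℝ) ≤ 12 * B * D),
          mul_le_mul_of_nonneg_left hm3 (by positivity : (0 : ℝ) ≤ 3 * K * D'),
          mul_le_mul_of_nonneg_left hm1 (by positivity : (0 : ℝ) ≤ 15 * K * D' * Θ)]

/-- **The clamped collisional counter-terms grow at most cubically in the velocity on the window** (template). [folklore] -/
theorem exists_abs_X_le {σ : ℝ} {Θc Pc Zc Z'c : ℝ × T3 → ℝ} {Uc : ℝ × T3 → V3} {dΘ dQ : Fin 3 → ℝ × T3 → ℝ}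
    (hΘ : Continuous Θc) (hP : Continuous Pc) (hZ : Continuous Zc) (hZ' : Continuous Z'c) (hU : Continuous Uc)
    (hdΘ : ∀ k, Continuous (dΘ k)) (hdQ : ∀ k, Continuous (dQ k)) (hΘ0 : ∀ p, Θc p ≠ 0) (s s' : ℝ) :
    ∃ C : ℝ, 0 ≤ C ∧ ∀ t ∈ Icc s s', ∀ (x : T3) (v : V3),
      |(∑ k : Fin 3, dQ k (t, x)) *
            (Θc (t, x) * (Pc (t, x) * σ ^ 3) * Z'c (t, x) + (1 / 3) * (Zc (t, x) - 1) * ‖v - Uc (t, x)‖ ^ 2) +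
          ((∑ k : Fin 3, Uc (t, x) k * dΘ k (t, x)) / (Θc (t, x)) ^ 2) *
            (Θc (t, x) * (Pc (t, x) * σ ^ 3) * Z'c (t, x) + (1 / 3) * (Zc (t, x) - 1) * ‖v - Uc (t, x)‖ ^ 2) +
          (Zc (t, x) - 1) * (∑ k : Fin 3, (v - Uc (t, x)) k * dΘ k (t, x)) / Θc (t, x)| ≤ C * (1 + ‖v‖) ^ 3 := by
  have h2 : ∀ p : ℝ × T3, Θc p ^ 2 ≠ 0 := fun p => pow_ne_zero 2 (hΘ0 p)
  obtain ⟨A₁, hA₁0, hA₁⟩ := exists_forall_norm_le_window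
    (show Continuous fun p : ℝ × T3 => ∑ k, dQ k p by fun_prop) s s'
  obtain ⟨A₂, hA₂0, hA₂⟩ := exists_forall_norm_le_window
    (show Continuous fun p : ℝ × T3 => (∑ k, Uc p k * dΘ k p) / (Θc p) ^ 2 by fun_prop (disch := assumption)) s s'
  obtain ⟨Cβ, hCβ0, hCβ⟩ := exists_forall_norm_le_window
    (show Continuous fun p : ℝ × T3 => Θc p * (Pc p * σ ^ 3) * Z'c p by fun_prop) s s'
  obtain ⟨Cγ, hCγ0, hCγ⟩ := exists_forall_norm_le_window (show Continuous fun p : ℝ × T3 => Zc p - 1 by fun_prop) s s'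
  obtain ⟨B, hB0, hB⟩ := exists_forall_norm_le_window
    (show Continuous fun p : ℝ × T3 => (Θc p)⁻¹ from hΘ.inv₀ hΘ0) s s'
  obtain ⟨W, hW0, hW⟩ := exists_forall_norm_le_window hU s s'
  obtain ⟨D', hD'0, hDk⟩ := exists_forall_abs_le_window hdΘ s s'
  refine ⟨(A₁ + A₂) * Cβ + (A₁ + A₂) * Cγ / 3 * (1 + W) ^ 2 + 3 * Cγ * D' * B * (1 + W), by positivity,
    fun t ht x v => ?_⟩
  set w : V3 := v - Uc (t, x) with hw_def
  have hA₁t : |∑ k : Fin 3, dQ k (t, x)| ≤ A₁ := by simpa only [Real.norm_eq_abs] using hA₁ t ht x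
  have hA₂t : |(∑ k : Fin 3, Uc (t, x) k * dΘ k (t, x)) / (Θc (t, x)) ^ 2| ≤ A₂ := by
    simpa only [Real.norm_eq_abs] using hA₂ t ht x
  have hβt : |Θc (t, x) * (Pc (t, x) * σ ^ 3) * Z'c (t, x)| ≤ Cβ := by
    simpa only [Real.norm_eq_abs] using hCβ t ht x
  have hγt : |Zc (t, x) - 1| ≤ Cγ := by simpa only [Real.norm_eq_abs] using hCγ t ht x
  have hBt : |(Θc (t, x))⁻¹| ≤ B := by simpa only [Real.norm_eq_abs] using hB t ht x
  have hwn : ‖w‖ ≤ ‖v‖ + W := (norm_sub_le _ _).trans (add_le_add le_rfl (hW t ht x))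
  -- the bracket `B = θ(ρσ³)Z′ + (Z−1)|w|²/3`
  have hBr : |Θc (t, x) * (Pc (t, x) * σ ^ 3) * Z'c (t, x) + (1 / 3) * (Zc (t, x) - 1) * ‖w‖ ^ 2| ≤
      Cβ + Cγ / 3 * ‖w‖ ^ 2 := by
    refine (abs_add_le _ _).trans (add_le_add hβt ?_)
    rw [abs_mul, abs_mul, abs_of_pos (by norm_num : (0 : ℝ) < 1 / 3), abs_of_nonneg (sq_nonneg ‖w‖)]
    nlinarith [mul_le_mul_of_nonneg_right hγt (sq_nonneg ‖w‖)]
  have hX1 : |(∑ k : Fin 3, dQ k (t, x)) *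
      (Θc (t, x) * (Pc (t, x) * σ ^ 3) * Z'c (t, x) + (1 / 3) * (Zc (t, x) - 1) * ‖w‖ ^ 2)| ≤
      A₁ * (Cβ + Cγ / 3 * ‖w‖ ^ 2) := by
    rw [abs_mul]; exact mul_le_mul hA₁t hBr (abs_nonneg _) hA₁0
  have hX2 : |((∑ k : Fin 3, Uc (t, x) k * dΘ k (t, x)) / (Θc (t, x)) ^ 2) *
      (Θc (t, x) * (Pc (t, x) * σ ^ 3) * Z'c (t, x) + (1 / 3) * (Zc (t, x) - 1) * ‖w‖ ^ 2)| ≤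
      A₂ * (Cβ + Cγ / 3 * ‖w‖ ^ 2) := by
    rw [abs_mul]; exact mul_le_mul hA₂t hBr (abs_nonneg _) hA₂0
  have hX3 : |(Zc (t, x) - 1) * (∑ k : Fin 3, w k * dΘ k (t, x)) / Θc (t, x)| ≤ Cγ * (3 * (‖w‖ * D')) * B := by
    rw [div_eq_mul_inv, abs_mul, abs_mul]
    exact mul_le_mul (mul_le_mul hγt (abs_sum_mul_le (hDk t ht x)) (abs_nonneg _) hCγ0) hBt (abs_nonneg _)
      (by positivity)
  obtain ⟨hm1, hm2, -⟩ := monomial_le (norm_nonneg w) (norm_nonneg v) hW0 hwn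
  have h13 : (1 : ℝ) ≤ (1 + ‖v‖) ^ 3 := one_le_pow₀ (by linarith [norm_nonneg v])
  calc _ ≤ |(∑ k : Fin 3, dQ k (t, x)) *
            (Θc (t, x) * (Pc (t, x) * σ ^ 3) * Z'c (t, x) + (1 / 3) * (Zc (t, x) - 1) * ‖w‖ ^ 2) +
          ((∑ k : Fin 3, Uc (t, x) k * dΘ k (t, x)) / (Θc (t, x)) ^ 2) *
            (Θc (t, x) * (Pc (t, x) * σ ^ 3) * Z'c (t, x) + (1 / 3) * (Zc (t, x) - 1) * ‖w‖ ^ 2)| +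
          |(Zc (t, x) - 1) * (∑ k : Fin 3, w k * dΘ k (t, x)) / Θc (t, x)| := abs_add_le _ _
    _ ≤ (A₁ * (Cβ + Cγ / 3 * ‖w‖ ^ 2) + A₂ * (Cβ + Cγ / 3 * ‖w‖ ^ 2)) + Cγ * (3 * (‖w‖ * D')) * B :=
        add_le_add ((abs_add_le _ _).trans (add_le_add hX1 hX2)) hX3
    _ ≤ ((A₁ + A₂) * Cβ + (A₁ + A₂) * Cγ / 3 * (1 + W) ^ 2 + 3 * Cγ * D' * B * (1 + W)) * (1 + ‖v‖) ^ 3 := by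
        nlinarith [mul_le_mul_of_nonneg_left hm2 (by positivity : (0 : ℝ) ≤ (A₁ + A₂) * Cγ / 3),
          mul_le_mul_of_nonneg_left hm1 (by positivity : (0 : ℝ) ≤ 3 * Cγ * D' * B),
          mul_le_mul_of_nonneg_left h13 (by positivity : (0 : ℝ) ≤ (A₁ + A₂) * Cβ)]

end Currents

end Summit.AtomisticToContinuum.HydrodynamicLimit.Theorems.LambertianContactSwapLambertianEulerProductionSplitTools

end
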